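import Literature.NumberTheory.LFunctions.DeuringPhenomenonDeepStripLemmaTwo
import Literature.NumberTheory.LFunctions.DeuringPhenomenonDeepStripEulerChain
import Literature.NumberTheory.LFunctions.SiegelZeroConductorPrimeFactors
import Literature.NumberTheory.LFunctions.DeuringPhenomenonWeakMordell
import HarnessLib

/-!
# Bellotti–Puglisi 2023, Theorem 1 and Corollary 1 (the Deuring phenomenon by elementary methods,
# `½ + ℓ ≤ σ ≤ 1`): the named facts `bellottiPuglisi2023_theorem1` and `_corollary1` DISCHARGED

Topic `Literature/NumberTheory/LFunctions` (namespace `Literature.NumberTheory.LFunctions`, helpers in the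
statement file's grouping sub-namespace `BellottiPuglisi2023`). PROOF LAYER (theorems only; no definition,
no named fact, no new hypothesis) for the statement file `ElementaryDeuringHeilbronnPhenomenon.lean` (cell
`parity-realchar`, SIEGEL INSTRUMENT, conditionals column, rows I.1/I.8: the Deuring direction «RH false ⟹
h(−q) → ∞ effectively»). Source: C. Bellotti, G. Puglisi, *Elementary methods in the study of the
Deuring–Heilbronn phenomenon*, Acta Arith. **208** (2023) 257–277 = arXiv:2201.03990v3, Theorem 1 (p. 3),
Corollary 1 (p. 4), proof §2 pp. 5–10.

PRINT (p. 3): "**Theorem 1.** Let `η, µ > 0` be real numbers with `η > max(µ, 1)`. Given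
`ℓ = (log log q)^{−µ}`, we define […] `H(ℓ, q) = {s = σ + it : |1 − s| ≥ (log q)^{−4}, ½ + ℓ ≤ σ ≤ 1,
|s| ≤ q^{ℓ/10}}`. If `h(−q) ≤ log q/(log log q)^η` then for each `s ∈ H(ℓ, q)` the relation
`L(s, χ) = (ζ(2s)/ζ(s)) ∏_{p∣q}(1 + p^{−s})[1 + O(exp{−⅓(log log q)^{η−µ}})]` holds." (p. 4):
"**Corollary 1.** If `ζ(β + iγ) = 0` with `β > ½`, then for every `η > 1` the relation
`h(−q) > log q/(log log q)^η` holds, provided that `q > q₀(β, γ, η)`." (p. 10, assembly): "`L(s,χ)ζ(s) =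
Σ_{n≤q} g(n)n^{−s} + O(exp{−⅓ log q/(log log q)^µ}) = Σ_{r∈R,r≤q} g(r)r^{−s} + O(exp{−(1/16)(log log q)^η})
= ζ(2s)∏_{p∣q}(1 + p^{−s})[1 + O(exp{−⅓(log log q)^{η−µ}})] + O(exp{−(1/16)(log log q)^η}) =
ζ(2s)∏_{p∣q}(1 + p^{−s})[1 + O(exp{−⅓(log log q)^{η−µ}})]`."

HERE (`X = log q`, `Y = log X`, `ℓ = Y^{−μ}`, `h = h_K ≤ X/Y^η`; all engines PROVED in the tree):
`BellottiPuglisi2023.lemma2` (`DeuringPhenomenonDeepStripLemmaTwo.lean`): `L(s,χ)ζ(s) = Σ_{n≤q} g(n)n^{−s}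
+ O(q^{−ℓ/2})`; `BellottiPuglisi2023.chain` (`DeuringPhenomenonDeepStripEulerChain.lean`): `Σ_{n≤q}
g(n)n^{−s} = V∏_{p∣q}(1 + p^{−s}) + O(2^{ω(q)}((1 + 1/(2σ−1))W + 2q^{½−σ}/(2σ−1)))`, `V = ζ(2s) +
O(R^{1−2σ}/(2σ−1))`, with (Lemma 3) `R = ⌊(q/4)^{1/(2h)}⌋` below every split prime
(`Pintz1976Deuring.root_lt_splitPrime`) and (Lemma 4) `W ≤ e^{8S₁} − 1`, `S₁ = Σ_{p≤q, χ(p)=1} p^{−σ} ≤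
h(4/q)^{1/(4h)} + q^{−ℓ/2}h(21 + 4X)` (`sum_rpow_smallSplitPrimes_le` for `p ≤ √q/2`;
`sum_charDivisorSum_div_sqrt_le` — the class-by-class ideal count, replacing "Lemma A of [24]" — for
`√q/2 < p ≤ q`); genus theory `2^{ω(q)} ≤ 2h` (`SiegelZeroClassNumber.two_pow_card_primeFactors_le_two_mul_
classNumber`); `‖ζ(2s)‖ ≥ σ − ½ ≥ ℓ`, `‖∏(1+p^{−s})‖ ≥ 4^{−ω(q)}`. Result: for `q ≥ q₀(η, μ)`,
`L(s,χ) ≠ 0`, `ζ(s) ≠ 0` and `‖L(s,χ) − M(s)‖ ≤ ‖M(s)‖ · 4 · exp(−⅓ Y^{η−μ})` on `H(ℓ, q)`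
(`BellottiPuglisi2023.theorem1_core`), whence **`bellottiPuglisi2023_theorem1_holds`** (with `C = 4`);
and **`bellottiPuglisi2023_corollary1_holds`** (a zero `β + iγ`, `β > ½`, of `ζ` lies in `H(ℓ, q)` for
`q` large with `μ = min(1, η−1)/2`, where `ζ ≠ 0` if `h(−q) ≤ log q/(log log q)^η`).

DECLARED DEVIATIONS from print: Hoffstein's kernel in Lemma 1 (no split at `σ = 7/8`); the ideal count in
place of Puglisi's Lemma 1 / Goldfeld's Lemma A; in Lemma 6 the common truncation `V` is isolated so
that the `R₀`-tail is relative to `∏(1+p^{−s})` exactly (the print's "`Σ_h μ²(h)h^{−s}[ζ(2s)+O(T)] =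
∏(1+p^{−s})[ζ(2s)+O(T)]`" would cost a factor `∏(1+p^{−σ})/|∏(1+p^{−s})| = e^{O(√log log q)}`, too much
when `η − μ ≤ ½`); `C = 4` and an existential effective threshold `q₀(η, μ)` (`Filter.eventually_atTop`
witnesses of elementary growth inequalities in `Y = log log q`). `theorem1_core` is one long assembly
proof (`set_option maxHeartbeats 1600000`).

LABEL (cell rule): instrument / proof layer (kernel). WHAT THIS IS NOT: no claim that `ζ` has a zero off
the critical line, nor that a field with `h(−q) ≤ log q/(log log q)^η` and large `q` exists; nothing here
bears on parity (H5).

## References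

* [BellottiPuglisi2023] Acta Arith. 208 (2023) 257–277 = arXiv:2201.03990v3: Theorem 1 p. 3, Corollary 1
  p. 4, §2 Lemmas 1–6 and the assembly pp. 5–10.
* [Pintz1976ElementaryIII] J. Pintz, Acta Arith. 31 (1976) 295–306 (the method; `σ > ¾` version = tree
  `pintz1976Deuring_theorem2_holds`).
-/

noncomputable section

open Complex Finset Filter Topology ArithmeticFunction

namespace Literature.NumberTheory.LFunctions

namespace BellottiPuglisi2023

open RealChar Pintz1976Deuring DirichletAbel
open Literature.NumberTheory.QuadraticFields

/-! ### Elementary helpers -/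

section Helpers

/-- For a prime `p` and `σ > 0`: `0 ≤ p^{−σ} < 1`. [folklore] -/
private theorem prime_rpow_neg_lt_one {p : ℕ} (hp : p.Prime) {σ : ℝ} (hσ : 0 < σ) :
    0 ≤ (p : ℝ) ^ (-σ) ∧ (p : ℝ) ^ (-σ) < 1 := by
  have hp1 : (1 : ℝ) < p := by exact_mod_cast hp.one_lt
  refine ⟨Real.rpow_nonneg (by linarith) _, ?_⟩
  rw [Real.rpow_neg (by linarith)]
  exact inv_lt_one_of_one_lt₀ (Real.one_lt_rpow hp1 hσ)

/-- For a prime `p` and `σ ≥ ½`: `p^{−σ} ≤ 3/4`. [folklore] -/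
private theorem prime_rpow_neg_le_three_quarters {p : ℕ} (hp : p.Prime) {σ : ℝ} (hσ : 1 / 2 ≤ σ) :
    (p : ℝ) ^ (-σ) ≤ 3 / 4 := by
  have hp2 : (2 : ℝ) ≤ p := by exact_mod_cast hp.two_le
  have h1 : (p : ℝ) ^ (-σ) ≤ (2 : ℝ) ^ (-σ) := Real.rpow_le_rpow_of_nonpos (by norm_num) hp2 (by linarith)
  have h2 : (2 : ℝ) ^ (-σ) ≤ (2 : ℝ) ^ (-(1 / 2) : ℝ) :=
    Real.rpow_le_rpow_of_exponent_le (by norm_num) (by linarith)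
  have h3 : (2 : ℝ) ^ (-(1 / 2) : ℝ) ≤ 3 / 4 := by
    have h4 : ((2 : ℝ) ^ (-(1 / 2) : ℝ)) ^ 2 = 1 / 2 := by
      rw [← Real.rpow_natCast, ← Real.rpow_mul (by norm_num)]; norm_num
    have h0 : 0 ≤ (2 : ℝ) ^ (-(1 / 2) : ℝ) := Real.rpow_nonneg (by norm_num) _
    nlinarith
  exact h1.trans (h2.trans h3)

/-- `(1 − u)^{−1} ≤ e^{4u}` for `0 ≤ u ≤ 3/4`. [folklore] -/
private theorem inv_one_sub_le_exp_four {u : ℝ} (hu0 : 0 ≤ u) (hu : u ≤ 3 / 4) :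
    (1 - u)⁻¹ ≤ Real.exp (4 * u) := by
  have h1u : 0 < 1 - u := by linarith
  have hkey : (1 - u)⁻¹ = u / (1 - u) + 1 := by field_simp; ring
  rw [hkey]
  refine (Real.add_one_le_exp _).trans (Real.exp_le_exp.mpr ?_)
  rw [div_le_iff₀ h1u]; nlinarith

/-- **The split-prime Euler factors**: for a finite set `P` of primes and `σ ≥ ½`,
`∏_{p∈P} (1 − p^{−σ})^{−2} ≤ exp(8 Σ_{p∈P} p^{−σ})`. [cite: BellottiPuglisi2023, §2 proof of Lemma 4 p. 8] -/
private theorem prod_inv_one_sub_sq_le_exp' {P : Finset ℕ} (hP : ∀ p ∈ P, p.Prime) {σ : ℝ}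
    (hσ : 1 / 2 ≤ σ) :
    ∏ p ∈ P, (1 - (p : ℝ) ^ (-σ))⁻¹ ^ 2 ≤ Real.exp (8 * ∑ p ∈ P, (p : ℝ) ^ (-σ)) := by
  have h1 : ∏ p ∈ P, (1 - (p : ℝ) ^ (-σ))⁻¹ ≤ Real.exp (4 * ∑ p ∈ P, (p : ℝ) ^ (-σ)) := by
    rw [Finset.mul_sum, Real.exp_sum]
    refine Finset.prod_le_prod (fun p hp => ?_) fun p hp => ?_
    · have := (prime_rpow_neg_lt_one (hP p hp) (by linarith : 0 < σ)).2
      exact inv_nonneg.mpr (by linarith)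
    · exact inv_one_sub_le_exp_four (Real.rpow_nonneg (Nat.cast_nonneg p) _)
        (prime_rpow_neg_le_three_quarters (hP p hp) hσ)
  rw [Finset.prod_pow, show 8 * ∑ p ∈ P, (p : ℝ) ^ (-σ) = (4 * ∑ p ∈ P, (p : ℝ) ^ (-σ)) * 2 by ring,
    Real.exp_mul, show ((2 : ℝ)) = ((2 : ℕ) : ℝ) by norm_num, Real.rpow_natCast]
  refine pow_le_pow_left₀ (Finset.prod_nonneg fun p hp => ?_) h1 2
  have := (prime_rpow_neg_lt_one (hP p hp) (by linarith : 0 < σ)).2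
  exact inv_nonneg.mpr (by linarith)

/-- `e^x − 1 ≤ 2x` for `0 ≤ x ≤ 1/2`. [folklore] -/
private theorem exp_sub_one_le_two_mul {x : ℝ} (hx0 : 0 ≤ x) (hx : x ≤ 1 / 2) :
    Real.exp x - 1 ≤ 2 * x := by
  have h1 : Real.exp x * (1 - x) ≤ 1 := by
    have := Real.one_sub_le_exp_neg x
    calc Real.exp x * (1 - x) ≤ Real.exp x * Real.exp (-x) :=
          mul_le_mul_of_nonneg_left this (Real.exp_nonneg _)
      _ = 1 := by rw [← Real.exp_add, add_neg_cancel, Real.exp_zero]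
  have h2 : Real.exp x ≤ 2 := by
    have := Real.exp_one_lt_d9
    calc Real.exp x ≤ Real.exp (1 / 2) := Real.exp_le_exp.mpr hx
      _ = Real.sqrt (Real.exp 1) := by rw [Real.sqrt_eq_rpow, ← Real.exp_mul]; norm_num
      _ ≤ Real.sqrt 4 := Real.sqrt_le_sqrt (by linarith)
      _ = 2 := by rw [show (4 : ℝ) = 2 ^ 2 by norm_num, Real.sqrt_sq (by norm_num)]
  nlinarith [Real.exp_nonneg x]

/-- `‖ζ(2s)‖ ≥ σ − ½` for `½ < σ ≤ 1` (`‖ζ(w)‖ ≥ (Re w − 1)/Re w`, tree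
`ZetaClassicalRegion.norm_riemannZeta_ge_of_one_lt_re`). [folklore] -/
private theorem norm_zeta_two_mul_ge' {s : ℂ} (hσ : 1 / 2 < s.re) (hσ1 : s.re ≤ 1) :
    s.re - 1 / 2 ≤ ‖riemannZeta (2 * s)‖ := by
  have h2re : (2 * s).re = 2 * s.re := by simp [Complex.mul_re]
  have h := ZetaClassicalRegion.norm_riemannZeta_ge_of_one_lt_re (s := 2 * s) (by rw [h2re]; linarith)
  refine le_trans ?_ h
  rw [h2re, le_div_iff₀ (by linarith)]
  nlinarith

/-- `‖∏_{p∣D}(1 + p^{−s})‖ ≥ 4^{−ω(D)}` for `σ ≥ ½` (`‖1 + p^{−s}‖ ≥ 1 − p^{−σ} ≥ ¼`). [folklore] -/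
private theorem norm_prod_one_add_ge {D : ℕ} {s : ℂ} (hσ : 1 / 2 ≤ s.re) :
    ((1 / 4 : ℝ)) ^ D.primeFactors.card ≤ ‖∏ p ∈ D.primeFactors, (1 + (p : ℂ) ^ (-s))‖ := by
  rw [Complex.norm_prod, ← Finset.prod_const]
  refine Finset.prod_le_prod (fun _ _ => by norm_num) fun p hp => ?_
  have hpp := Nat.prime_of_mem_primeFactors hp
  have hnormp : ‖(p : ℂ) ^ (-s)‖ = (p : ℝ) ^ (-s.re) := by
    rw [Complex.norm_natCast_cpow_of_pos hpp.pos, Complex.neg_re]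
  have hle := prime_rpow_neg_le_three_quarters hpp hσ
  have h := norm_sub_norm_le (1 : ℂ) (-((p : ℂ) ^ (-s)))
  rw [norm_neg, norm_one, sub_neg_eq_add, hnormp] at h
  linarith

/-- For `x ≥ 1`: `x/2 ≤ ⌊x⌋₊`. [folklore] -/
private theorem half_le_floor {x : ℝ} (hx : 1 ≤ x) : x / 2 ≤ (⌊x⌋₊ : ℝ) := by
  have h1 : (1 : ℝ) ≤ ⌊x⌋₊ := by exact_mod_cast Nat.one_le_iff_ne_zero.mpr (Nat.floor_pos.mpr hx).ne'
  have h2 : x < ⌊x⌋₊ + 1 := Nat.lt_floor_add_one x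
  linarith

end Helpers

/-! ### The thresholds ("provided that `q > q₀`") -/

section Thresholds

/-- The growth conditions behind "for `q ≥ q₀(η, μ)`", in the variable `Y = log log q`: for all large
`Y`, (0) `Y ≥ 2`; (1) `Y^{2μ} e^{−½Y^{η−μ}} ≤ e^{−⅓Y^{η−μ}}`; (2) `A₂ e^{4Y} Y^{2μ} e^{−Y^η/8} ≤
e^{−⅓Y^{η−μ}}`; (3) `A₃ e^{5Y} Y^{2μ} e^{−½ e^Y Y^{−μ}} ≤ e^{−⅓Y^{η−μ}}`; (4) `e^{−⅓Y^{η−μ}} ≤ ⅛`.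
[cite: BellottiPuglisi2023, §2 pp. 6–10 ("≪", "q sufficiently large")] -/
private theorem eventually_thresholds {μ η : ℝ} (hμ : 0 < μ) (hημ : μ < η) (hη1 : 1 < η)
    {A₂ A₃ : ℝ} (hA₂ : 0 < A₂) (hA₃ : 0 < A₃) :
    ∃ Y₀ : ℝ, ∀ Y : ℝ, Y₀ ≤ Y →
      2 ≤ Y ∧
      Y ^ (2 * μ) * Real.exp (-(1 / 2) * Y ^ (η - μ)) ≤ Real.exp (-(1 / 3) * Y ^ (η - μ)) ∧
      A₂ * Real.exp (4 * Y) * Y ^ (2 * μ) * Real.exp (-(1 / 8) * Y ^ η) ≤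
        Real.exp (-(1 / 3) * Y ^ (η - μ)) ∧
      A₃ * Real.exp (5 * Y) * Y ^ (2 * μ) * Real.exp (-(1 / 2) * (Real.exp Y * Y ^ (-μ))) ≤
        Real.exp (-(1 / 3) * Y ^ (η - μ)) ∧
      Real.exp (-(1 / 3) * Y ^ (η - μ)) ≤ 1 / 8 := by
  set c₃ : ℝ := |Real.log A₃| + 6 + 2 * μ with hc₃
  have hc₃0 : 0 < c₃ := by positivity
  -- the eventualities
  have e0 : ∀ᶠ Y : ℝ in atTop, 2 ≤ Y := Filter.eventually_ge_atTop 2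
  have e1 : ∀ᶠ Y : ℝ in atTop, Real.log Y ≤ 1 / (12 * μ + 1) * Y ^ (η - μ) := by
    have hb := (isLittleO_log_rpow_atTop (by linarith : 0 < η - μ)).bound
      (show 0 < 1 / (12 * μ + 1) by positivity)
    filter_upwards [hb, Filter.eventually_ge_atTop 1] with Y hY hY1
    rw [Real.norm_of_nonneg (Real.log_nonneg hY1), Real.norm_of_nonneg (Real.rpow_nonneg (by linarith) _)]
      at hY
    exact hY
  have e2a : ∀ᶠ Y : ℝ in atTop, 8 ≤ Y ^ μ := (tendsto_rpow_atTop hμ).eventually_ge_atTop 8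
  have e2b : ∀ᶠ Y : ℝ in atTop, 12 * (|Real.log A₂| + 5 + 2 * μ) ≤ Y ^ (η - 1) :=
    (tendsto_rpow_atTop (by linarith : 0 < η - 1)).eventually_ge_atTop _
  have e3 : ∀ᶠ Y : ℝ in atTop, Y ^ (η + μ + 1) * Real.exp (-(1 : ℝ) * Y) ≤ 1 / (2 * c₃) := by
    have ht := tendsto_rpow_mul_exp_neg_mul_atTop_nhds_zero (η + μ + 1) 1 one_pos
    exact (ht.eventually (Iic_mem_nhds (by positivity))).mono fun Y hY => hY
  have e4 : ∀ᶠ Y : ℝ in atTop, 7 ≤ Y ^ (η - μ) :=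
    (tendsto_rpow_atTop (by linarith : 0 < η - μ)).eventually_ge_atTop 7
  obtain ⟨Y₀, hY₀⟩ := Filter.eventually_atTop.mp (e0.and (e1.and (e2a.and (e2b.and (e3.and e4)))))
  refine ⟨Y₀, fun Y hY => ?_⟩
  obtain ⟨hY2, hlog, hμ8, hη1', hexp, h5⟩ := hY₀ Y hY
  have hY0 : 0 < Y := by linarith
  have hY1 : 1 ≤ Y := by linarith
  have hlogY0 : 0 ≤ Real.log Y := Real.log_nonneg hY1
  have hlogY : Real.log Y ≤ Y := (Real.log_le_sub_one_of_pos hY0).trans (by linarith)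
  -- `Y^{2μ} = e^{2μ log Y}`
  have hY2μ : Y ^ (2 * μ) = Real.exp (2 * μ * Real.log Y) := by
    rw [Real.rpow_def_of_pos hY0]; ring_nf
  have hpow0 : 0 < Y ^ (η - μ) := Real.rpow_pos_of_pos hY0 _
  have hpowη : 0 < Y ^ η := Real.rpow_pos_of_pos hY0 _
  -- `Y^{η−μ} = Y^η / Y^μ ≤ Y^η/8`
  have hsplit : Y ^ (η - μ) * Y ^ μ = Y ^ η := by
    rw [← Real.rpow_add hY0]; ring_nf
  have hημ8 : 8 * Y ^ (η - μ) ≤ Y ^ η := by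
    rw [← hsplit]; nlinarith
  -- monomials `≤ Y^{η+μ+1}` for `Y ≥ 1`
  have hmono : ∀ {a b : ℝ}, a ≤ b → Y ^ a ≤ Y ^ b := fun hab =>
    Real.rpow_le_rpow_of_exponent_le hY1 hab
  refine ⟨hY2, ?_, ?_, ?_, ?_⟩
  · -- (1): `2μ log Y ≤ Y^{η−μ}/6`
    rw [hY2μ, ← Real.exp_add, Real.exp_le_exp]
    have : 2 * μ * Real.log Y ≤ 1 / 6 * Y ^ (η - μ) := by
      calc 2 * μ * Real.log Y ≤ 2 * μ * (1 / (12 * μ + 1) * Y ^ (η - μ)) :=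
            mul_le_mul_of_nonneg_left hlog (by linarith)
        _ = (2 * μ / (12 * μ + 1)) * Y ^ (η - μ) := by ring
        _ ≤ 1 / 6 * Y ^ (η - μ) := by
            refine mul_le_mul_of_nonneg_right ?_ hpow0.le
            rw [div_le_iff₀ (by positivity)]; linarith
    linarith
  · -- (2): `log A₂ + 4Y + 2μ log Y − Y^η/8 ≤ −⅓Y^{η−μ}`
    rw [hY2μ, ← Real.exp_log hA₂, ← Real.exp_add, ← Real.exp_add, ← Real.exp_add, Real.exp_le_exp]
    have hY1' : Y ^ η = Y * Y ^ (η - 1) := by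
      rw [show η = 1 + (η - 1) by ring, Real.rpow_add hY0, Real.rpow_one]; ring_nf
    have hbig : 12 * (|Real.log A₂| + 5 + 2 * μ) * Y ≤ Y ^ η := by
      rw [hY1']; nlinarith
    have hl : Real.log A₂ ≤ |Real.log A₂| := le_abs_self _
    nlinarith [abs_nonneg (Real.log A₂)]
  · -- (3): `log A₃ + 5Y + 2μ log Y − ½ e^Y Y^{−μ} ≤ −⅓Y^{η−μ}`
    rw [hY2μ, ← Real.exp_log hA₃, ← Real.exp_add, ← Real.exp_add, ← Real.exp_add, Real.exp_le_exp]
    -- `e^Y ≥ 2 c₃ Y^{η+μ+1}`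
    have hexpY : 2 * c₃ * Y ^ (η + μ + 1) ≤ Real.exp Y := by
      rw [show -(1 : ℝ) * Y = -Y by ring, Real.exp_neg, mul_inv_le_iff₀ (Real.exp_pos Y)] at hexp
      calc 2 * c₃ * Y ^ (η + μ + 1) ≤ 2 * c₃ * (1 / (2 * c₃) * Real.exp Y) :=
            mul_le_mul_of_nonneg_left hexp (by positivity)
        _ = Real.exp Y := by field_simp
    -- `c₃ Y^{η+μ+1} Y^{−μ} = c₃ Y^{η+1} ≥ (|log A₃| + 5 + 2μ) Y · Y^μ-free …`
    have hYμ0 : 0 < Y ^ (-μ) := Real.rpow_pos_of_pos hY0 _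
    have hprod : Y ^ (η + μ + 1) * Y ^ (-μ) = Y ^ (η + 1) := by
      rw [← Real.rpow_add hY0]; ring_nf
    have hη1le : Y ≤ Y ^ (η + 1) := by
      calc Y = Y ^ (1 : ℝ) := (Real.rpow_one Y).symm
        _ ≤ Y ^ (η + 1) := hmono (by linarith)
    have hημle : Y ^ (η - μ) ≤ Y ^ (η + 1) := hmono (by linarith)
    have h0le : (1 : ℝ) ≤ Y ^ (η + 1) := by linarith
    have hmain : 1 / 2 * (Real.exp Y * Y ^ (-μ)) ≥ c₃ * Y ^ (η + 1) := by
      rw [← hprod]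
      have := mul_le_mul_of_nonneg_right hexpY hYμ0.le
      nlinarith
    have hl : Real.log A₃ ≤ |Real.log A₃| := le_abs_self _
    rw [hc₃] at hmain
    nlinarith [abs_nonneg (Real.log A₃), mul_nonneg hμ.le hlogY0]
  · -- (4): `Y^{η−μ} ≥ 7 > 3 log 8`
    rw [show (1 / 8 : ℝ) = Real.exp (-Real.log 8) by rw [Real.exp_neg, Real.exp_log (by norm_num)]; norm_num,
      Real.exp_le_exp]
    have hlog8 : Real.log 8 < 7 / 3 := by
      have := Real.log_two_lt_d9
      rw [show (8 : ℝ) = 2 ^ 3 by norm_num, Real.log_pow]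
      push_cast; linarith
    nlinarith

end Thresholds

/-! ### Theorem 1 in the `D`-pattern (modulus `D = |d_K|` as a parameter) -/

section Core

set_option maxHeartbeats 1600000 in
/-- **Bellotti–Puglisi, Theorem 1 — core form.** For `0 < μ`, `max(μ,1) < η` there is an effective
`D₀ = D₀(η, μ)` such that for every imaginary quadratic field `K` with `|d_K| = D ≥ D₀` and
`h_K ≤ log D/(log log D)^η`, the odd quadratic primitive character `χ` mod `D`, and every
`s ∈ H(ℓ, D)` (`ℓ = (log log D)^{−μ}`): `L(s, χ) ≠ 0`, `ζ(s) ≠ 0` and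
`‖L(s, χ) − M(s)‖ ≤ ‖M(s)‖ · 4 · exp(−⅓(log log D)^{η−μ})`, `M(s) = ζ(2s)ζ(s)⁻¹∏_{p∣D}(1 + p^{−s})`.
[cite: BellottiPuglisi2023, Theorem 1 p. 3; proof §2 pp. 5–10 (Lemmas 1–6 and the assembly p. 10)] -/
theorem theorem1_core {μ η : ℝ} (hμ : 0 < μ) (hη : max μ 1 < η) :
    ∃ D₀ : ℕ, ∀ (D : ℕ) [NeZero D] (K : Type) [Field K] [NumberField K],
      Module.finrank ℚ K = 2 → NumberField.discr K < 0 → (NumberField.discr K).natAbs = D →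
      D₀ ≤ D → (NumberField.classNumber K : ℝ) ≤ Real.log D / Real.log (Real.log D) ^ η →
      ∀ χ : DirichletCharacter ℂ D, χ.IsQuadratic → χ.IsPrimitive → χ.Odd →
      ∀ s : ℂ, s ∈ region μ D →
        χ.LFunction s ≠ 0 ∧ riemannZeta s ≠ 0 ∧
        ‖χ.LFunction s - mainTerm D s‖ ≤
          ‖mainTerm D s‖ * 4 * Real.exp (-(1 / 3) * Real.log (Real.log D) ^ (η - μ)) := by
  classical
  have hημ : μ < η := lt_of_le_of_lt (le_max_left _ _) hη
  have hη1 : 1 < η := lt_of_le_of_lt (le_max_right _ _) hη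
  obtain ⟨D₂, hD₂⟩ := lemma2 hμ
  obtain ⟨Y₀, hY₀⟩ := eventually_thresholds hμ hημ hη1 (by norm_num : (0 : ℝ) < 192)
    (by norm_num : (0 : ℝ) < 4812)
  refine ⟨max (max D₂ 16) ⌈Real.exp (Real.exp Y₀)⌉₊, ?_⟩
  intro D _ K _ _ h2 hd hKDn hD₀ hh χ hquad hprim hodd s hs
  have hq : χ ^ 2 = 1 := MulChar.IsQuadratic.sq_eq_one hquad
  have hKD : NumberField.discr K = -(D : ℤ) := by
    have := Int.ofNat_natAbs_of_nonpos hd.le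
    rw [hKDn] at this; omega
  /- (0) sizes: `D ≥ 16`, `X = log D ≥ 3`, `Y = log X ≥ max(2, Y₀)` -/
  have hD₂D : D₂ ≤ D := le_trans (le_trans (le_max_left _ _) (le_max_left _ _)) hD₀
  have hD16 : 16 ≤ D := le_trans (le_trans (le_max_right _ _) (le_max_left _ _)) hD₀
  have hDexp : ⌈Real.exp (Real.exp Y₀)⌉₊ ≤ D := le_trans (le_max_right _ _) hD₀
  have hDr : (16 : ℝ) ≤ D := by exact_mod_cast hD16
  have hD0 : (0 : ℝ) < D := by linarith
  have hD1 : (1 : ℝ) < D := by linarith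
  set X : ℝ := Real.log D with hX
  have hXexp : Real.exp Y₀ ≤ X := by
    rw [hX, Real.le_log_iff_exp_le hD0]
    exact le_trans (Nat.le_ceil _) (by exact_mod_cast hDexp)
  have hX0 : 0 < X := lt_of_lt_of_le (Real.exp_pos _) hXexp
  have hXne : X ≠ 0 := hX0.ne'
  set Y : ℝ := Real.log X with hY
  have hYY₀ : Y₀ ≤ Y := by rw [hY, Real.le_log_iff_exp_le hX0]; exact hXexp
  obtain ⟨hY2, hth1, hth2, hth3, hth4⟩ := hY₀ Y hYY₀
  have hY0 : 0 < Y := by linarith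
  have hY1 : 1 ≤ Y := by linarith
  have hexpY : Real.exp Y = X := by rw [hY, Real.exp_log hX0]
  have hX3 : 3 ≤ X := by have := Real.add_one_le_exp Y; linarith
  have hX1 : 1 ≤ X := by linarith
  -- the small quantities `E₀ = e^{−⅓Y^{η−μ}}`, `δ₁ = e^{−Y^η/8}`, `ℓ = Y^{−μ}`, `δ₂ = D^{−ℓ/2}`
  set E₀ : ℝ := Real.exp (-(1 / 3) * Y ^ (η - μ)) with hE₀
  set δ₁ : ℝ := Real.exp (-(1 / 8) * Y ^ η) with hδ₁
  set ℓ : ℝ := Y ^ (-μ) with hℓ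
  set Yμ : ℝ := Y ^ μ with hYμ
  have hE₀0 : 0 < E₀ := Real.exp_pos _
  have hδ₁0 : 0 < δ₁ := Real.exp_pos _
  have hYμ1 : 1 ≤ Yμ := Real.one_le_rpow hY1 hμ.le
  have hYμ0 : 0 < Yμ := by linarith
  have hYμne : Yμ ≠ 0 := hYμ0.ne'
  have hℓeq : ℓ = Yμ⁻¹ := by rw [hℓ, hYμ, Real.rpow_neg hY0.le]
  have hℓ0 : 0 < ℓ := by rw [hℓeq]; positivity
  have hℓ1 : ℓ ≤ 1 := by rw [hℓeq]; exact inv_le_one_of_one_le₀ hYμ1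
  have hY2μ : Y ^ (2 * μ) = Yμ * Yμ := by rw [hYμ, ← Real.rpow_add hY0]; ring_nf
  have hX4 : Real.exp (4 * Y) = X ^ 4 := by
    rw [← hexpY, ← Real.exp_nat_mul]; norm_num
  have hX5 : Real.exp (5 * Y) = X ^ 5 := by
    rw [← hexpY, ← Real.exp_nat_mul]; norm_num
  rw [hY2μ] at hth1 hth2 hth3
  rw [hX4] at hth2
  rw [hX5, hexpY] at hth3
  set δ₂ : ℝ := (D : ℝ) ^ (-ℓ / 2) with hδ₂
  have hδ₂0 : 0 < δ₂ := Real.rpow_pos_of_pos hD0 _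
  have hδ₂exp : Real.exp (-(1 / 2) * (X * ℓ)) = δ₂ := by
    rw [hδ₂, Real.rpow_def_of_pos hD0, ← hX]; congr 1; ring
  rw [hδ₂exp] at hth3
  -- now `hth1 : Yμ Yμ e^{−½Y^{η−μ}} ≤ E₀`, `hth2 : 192 X⁴ Yμ² δ₁ ≤ E₀`,
  -- `hth3 : 4812 X⁵ Yμ² δ₂ ≤ E₀`, `hth4 : E₀ ≤ 1/8`.
  /- (1) the region `H(ℓ, D)`: `½ + ℓ ≤ σ ≤ 1` -/
  obtain ⟨-, hσℓ, hσ1, -⟩ := id hs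
  rw [← hX, ← hY, ← hℓ] at hσℓ
  have hσ : 1 / 2 < s.re := by linarith
  have hσ0 : 1 / 2 ≤ s.re := hσ.le
  have hσpos : 0 < s.re := by linarith
  have h2σ1 : 2 * ℓ ≤ 2 * s.re - 1 := by linarith
  have hℓ2pos : 0 < 2 * ℓ := by linarith
  /- (2) class number: `1 ≤ h ≤ X`, `h Y^η ≤ X` -/
  set h : ℝ := (NumberField.classNumber K : ℝ) with hhdef
  have hh1 : 1 ≤ h := by rw [hhdef]; exact_mod_cast NumberField.classNumber_pos K
  have hh0 : 0 < h := by linarith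
  have hYη1 : 1 ≤ Y ^ η := Real.one_le_rpow hY1 (by linarith)
  have hYη0 : 0 < Y ^ η := by linarith
  have hhY : h * Y ^ η ≤ X := by rwa [le_div_iff₀ hYη0] at hh
  have hhX : h ≤ X := by
    calc h = h * 1 := (mul_one h).symm
      _ ≤ h * Y ^ η := mul_le_mul_of_nonneg_left hYη1 hh0.le
      _ ≤ X := hhY
  /- (3) Lemma 2: `‖T − ζ(s)L(s)‖ ≤ δ₂`, `T = Σ_{n ≤ D} g(n) n^{−s}` -/
  have hIcc : Finset.Icc 1 D = Finset.Ioc 0 D := by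
    ext n; simp only [Finset.mem_Icc, Finset.mem_Ioc]; omega
  have hT2 := hD₂ D K h2 hKD hD₂D hhX χ hquad hprim hodd s hs
  rw [hIcc, ← hX, ← hY, ← hℓ] at hT2
  /- (4) Lemma 3: `R = ⌊(D/4)^{1/(2h)}⌋` lies below every split prime; `1 ≤ R ≤ D`, `R ≥ x₀/2` -/
  set x₀ : ℝ := ((D : ℝ) / 4) ^ (1 / (2 * h)) with hx₀
  have hD4 : (1 : ℝ) ≤ (D : ℝ) / 4 := by rw [le_div_iff₀ (by norm_num : (0 : ℝ) < 4)]; linarith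
  have hD4pos : (0 : ℝ) < (D : ℝ) / 4 := by positivity
  have hx₀1 : 1 ≤ x₀ := Real.one_le_rpow hD4 (by positivity)
  have hx₀0 : 0 < x₀ := by linarith
  have hx₀D : x₀ ≤ D := by
    calc x₀ ≤ ((D : ℝ) / 4) ^ (1 : ℝ) := by
          refine Real.rpow_le_rpow_of_exponent_le hD4 ?_
          rw [div_le_iff₀ (by positivity)]; linarith
      _ = (D : ℝ) / 4 := Real.rpow_one _
      _ ≤ D := by linarith
  set R : ℕ := ⌊x₀⌋₊ with hR
  have hR1 : 1 ≤ R := Nat.floor_pos.mpr hx₀1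
  have hRx₀ : (R : ℝ) ≤ x₀ := Nat.floor_le hx₀0.le
  have hRhalf : x₀ / 2 ≤ (R : ℝ) := half_le_floor hx₀1
  have hR1r : (1 : ℝ) ≤ R := by exact_mod_cast hR1
  have hRD : R ≤ D := by
    have : (R : ℝ) ≤ D := hRx₀.trans hx₀D
    exact_mod_cast this
  have hRsplit : ∀ p, p.Prime → reChar χ p = 1 → R < p := by
    intro p hp h1
    have hlt := root_lt_splitPrime χ h2 hd hKDn hprim hquad hodd hp h1
    have : (R : ℝ) < p := lt_of_le_of_lt hRx₀ hlt
    exact_mod_cast this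
  /- (5) the `R`-tail: `R^{1−2σ}/(2σ−1) ≤ 2 ℓ E₀` -/
  have hlog2pos : 0 < Real.log 2 := Real.log_pos (by norm_num)
  have hlog4 : Real.log 4 = 2 * Real.log 2 := by
    rw [show (4 : ℝ) = 2 ^ 2 by norm_num, Real.log_pow]; push_cast; ring
  have hlog2 : Real.log 2 < 3 / 4 := by have := Real.log_two_lt_d9; linarith
  have hℓYη : ℓ * Y ^ η = Y ^ (η - μ) := by
    rw [hℓ, ← Real.rpow_add hY0]; ring_nf
  have hRpow : (R : ℝ) ^ (1 - 2 * s.re) ≤ 4 * Real.exp (-(1 / 2) * Y ^ (η - μ)) := by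
    have e1 : (R : ℝ) ^ (1 - 2 * s.re) ≤ (R : ℝ) ^ (-(2 * ℓ)) :=
      Real.rpow_le_rpow_of_exponent_le hR1r (by linarith)
    have e2 : (R : ℝ) ^ (-(2 * ℓ)) ≤ (x₀ / 2) ^ (-(2 * ℓ)) :=
      Real.rpow_le_rpow_of_nonpos (by positivity) hRhalf (by linarith)
    have e3 : (x₀ / 2) ^ (-(2 * ℓ)) = Real.exp (-(2 * ℓ) * (Real.log x₀ - Real.log 2)) := by
      rw [Real.rpow_def_of_pos (by positivity), Real.log_div hx₀0.ne' (by norm_num)]; ring_nf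
    have hlogx₀ : Real.log x₀ = (X - 2 * Real.log 2) / (2 * h) := by
      rw [hx₀, Real.log_rpow hD4pos, Real.log_div hD0.ne' (by norm_num), ← hX, hlog4]; ring
    have e4 : -(2 * ℓ) * (Real.log x₀ - Real.log 2) ≤
        2 * Real.log 2 + -(1 / 2) * Y ^ (η - μ) := by
      rw [hlogx₀]
      have hXl : ℓ * (X / 2) ≤ ℓ * (X - 2 * Real.log 2) :=
        mul_le_mul_of_nonneg_left (by linarith) hℓ0.le
      have hkey : (1 / 2) * Y ^ (η - μ) ≤ ℓ * (X - 2 * Real.log 2) / h := by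
        rw [← hℓYη, le_div_iff₀ hh0]
        have : ℓ * (h * Y ^ η) ≤ ℓ * X := mul_le_mul_of_nonneg_left hhY hℓ0.le
        linarith
      have hl2 : 2 * ℓ * Real.log 2 ≤ 2 * Real.log 2 := by
        have := mul_le_mul_of_nonneg_right hℓ1 hlog2pos.le; linarith
      have : -(2 * ℓ) * ((X - 2 * Real.log 2) / (2 * h) - Real.log 2) =
          -(ℓ * (X - 2 * Real.log 2) / h) + 2 * ℓ * Real.log 2 := by
        field_simp; ring
      rw [this]; linarith
    calc (R : ℝ) ^ (1 - 2 * s.re) ≤ (x₀ / 2) ^ (-(2 * ℓ)) := e1.trans e2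
      _ = Real.exp (-(2 * ℓ) * (Real.log x₀ - Real.log 2)) := e3
      _ ≤ Real.exp (2 * Real.log 2 + -(1 / 2) * Y ^ (η - μ)) := Real.exp_le_exp.mpr e4
      _ = 4 * Real.exp (-(1 / 2) * Y ^ (η - μ)) := by
          rw [Real.exp_add, ← hlog4, Real.exp_log (by norm_num)]
  have htailR : (R : ℝ) ^ (1 - 2 * s.re) / (2 * s.re - 1) ≤ 2 * ℓ * E₀ := by
    have e1 : (R : ℝ) ^ (1 - 2 * s.re) / (2 * s.re - 1) ≤
        4 * Real.exp (-(1 / 2) * Y ^ (η - μ)) / (2 * ℓ) :=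
      div_le_div₀ (by positivity) hRpow hℓ2pos h2σ1
    rw [hℓeq] at e1 ⊢
    calc _ ≤ 4 * Real.exp (-(1 / 2) * Y ^ (η - μ)) / (2 * Yμ⁻¹) := e1
      _ = 2 * Yμ⁻¹ * (Yμ * Yμ * Real.exp (-(1 / 2) * Y ^ (η - μ))) := by field_simp; ring
      _ ≤ 2 * Yμ⁻¹ * E₀ := mul_le_mul_of_nonneg_left hth1 (by positivity)
  /- (6) Lemmas 5–6: the Euler chain with `N = D` -/
  obtain ⟨V, hV, hTV⟩ := chain χ hq hσ hσ1 (le_refl D) hR1 hRD hRsplit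
  set T : ℂ := ∑ n ∈ Ioc 0 D, (charDivisorSum χ n : ℂ) * (n : ℂ) ^ (-s) with hT
  set P : ℂ := ∏ p ∈ D.primeFactors, (1 + (p : ℂ) ^ (-s)) with hPdef
  set ω : ℕ := D.primeFactors.card with hω
  set Wsum : ℝ := ∑ a ∈ (Ioc 0 D).filter (fun a => ∀ p ∈ a.primeFactors, reChar χ p = 1),
      charDivisorSum χ a * (a : ℝ) ^ (-s.re) with hWsum
  -- genus theory: `2^ω ≤ 2h ≤ 2X`
  have hA : (2 : ℝ) ^ ω ≤ 2 * h :=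
    SiegelZeroClassNumber.two_pow_card_primeFactors_le_two_mul_classNumber h2 hKD (by omega)
  -- `1 + 1/(2σ−1) ≤ (3/2) Yμ` and `2 D^{½−σ}/(2σ−1) ≤ Yμ δ₂`
  have hB : 1 + 1 / (2 * s.re - 1) ≤ 3 / 2 * Yμ := by
    have h1 : 1 / (2 * s.re - 1) ≤ 1 / (2 * ℓ) := one_div_le_one_div_of_le hℓ2pos h2σ1
    rw [hℓeq] at h1
    have h2 : 1 / (2 * Yμ⁻¹) = Yμ / 2 := by field_simp
    linarith
  have hDpow : (D : ℝ) ^ (1 / 2 - s.re) ≤ δ₂ :=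
    Real.rpow_le_rpow_of_exponent_le hD1.le (by linarith)
  have htN : 2 * (D : ℝ) ^ (1 / 2 - s.re) / (2 * s.re - 1) ≤ Yμ * δ₂ := by
    calc 2 * (D : ℝ) ^ (1 / 2 - s.re) / (2 * s.re - 1) ≤ 2 * δ₂ / (2 * ℓ) :=
          div_le_div₀ (by positivity) (by linarith) hℓ2pos h2σ1
      _ = Yμ * δ₂ := by
          rw [mul_div_mul_left _ _ (two_ne_zero), div_eq_mul_inv, hℓeq, inv_inv, mul_comm]
  /- (7) Lemma 4: `W ≤ e^{8S₁} − 1 ≤ 16 S₁`, `S₁ = Σ_{p ≤ D, χ(p)=1} p^{−σ} ≤ X δ₁ + 25 X² δ₂` -/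
  set Psplit : Finset ℕ := (D + 1).primesBelow.filter (fun p => reChar χ p = 1) with hPsplit
  set S₁ : ℝ := ∑ p ∈ Psplit, (p : ℝ) ^ (-s.re) with hS₁
  have hPsplit_prime : ∀ p ∈ Psplit, p.Prime := fun p hp =>
    (Nat.mem_primesBelow.mp (Finset.mem_filter.mp hp).1).2
  have hWexp : Wsum ≤ Real.exp (8 * S₁) :=
    (sum_split_le_prod χ hq hσpos D).trans (prod_inv_one_sub_sq_le_exp' hPsplit_prime hσ0)
  have hS₁split : S₁ = (∑ p ∈ Psplit.filter (fun p => 4 * p ^ 2 ≤ D), (p : ℝ) ^ (-s.re)) +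
      ∑ p ∈ Psplit.filter (fun p => ¬ 4 * p ^ 2 ≤ D), (p : ℝ) ^ (-s.re) :=
    (Finset.sum_filter_add_sum_filter_not Psplit _ _).symm
  -- small split primes (`p ≤ √D/2`): at most `h`, each `> (D/4)^{1/(2h)}`
  have hSa : ∑ p ∈ Psplit.filter (fun p => 4 * p ^ 2 ≤ D), (p : ℝ) ^ (-s.re) ≤ X * δ₁ := by
    have hP : ∀ p ∈ Psplit.filter (fun p => 4 * p ^ 2 ≤ D),
        p.Prime ∧ 4 * p ^ 2 ≤ D ∧ reChar χ p = 1 := by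
      intro p hp
      rw [Finset.mem_filter] at hp
      exact ⟨hPsplit_prime p hp.1, hp.2, (Finset.mem_filter.mp hp.1).2⟩
    have h1 := sum_rpow_smallSplitPrimes_le χ h2 hd hKDn hprim hquad hodd hσpos _ hP
    have hb1 : 4 / (D : ℝ) ≤ 1 := by rw [div_le_one hD0]; linarith
    have hb0 : 0 < 4 / (D : ℝ) := by positivity
    have h2' : (4 / (D : ℝ)) ^ (s.re / (2 * h)) ≤ (4 / (D : ℝ)) ^ (1 / (4 * h)) := by
      refine Real.rpow_le_rpow_of_exponent_ge hb0 hb1 ?_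
      rw [div_le_div_iff₀ (by positivity) (by positivity)]
      have := mul_le_mul_of_nonneg_right hσ0 (by positivity : (0 : ℝ) ≤ 4 * h); linarith
    have h3 : (4 / (D : ℝ)) ^ (1 / (4 * h)) ≤ δ₁ := by
      rw [Real.rpow_def_of_pos hb0, Real.log_div (by norm_num) hD0.ne', ← hX, hδ₁, Real.exp_le_exp,
        ← sub_nonneg]
      have : -(1 / 8) * Y ^ η - (Real.log 4 - X) * (1 / (4 * h)) =
          (2 * (X - Real.log 4) - h * Y ^ η) / (8 * h) := by
        field_simp; ring
      rw [this]
      exact div_nonneg (by linarith) (by positivity)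
    calc _ ≤ h * (4 / (D : ℝ)) ^ (s.re / (2 * h)) := h1
      _ ≤ h * δ₁ := mul_le_mul_of_nonneg_left (h2'.trans h3) hh0.le
      _ ≤ X * δ₁ := mul_le_mul_of_nonneg_right hhX hδ₁0.le
  -- large split primes (`√D/2 < p ≤ D`): `p^{−σ} ≤ δ₂ g(p)/√p`, then the class-by-class ideal count
  have hSb : ∑ p ∈ Psplit.filter (fun p => ¬ 4 * p ^ 2 ≤ D), (p : ℝ) ^ (-s.re) ≤
      25 * X ^ 2 * δ₂ := by
    have h4half : (1 / 2 : ℝ) ≤ (4 : ℝ) ^ (-ℓ / 2) := by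
      have e : (4 : ℝ) ^ (-(1 / 2) : ℝ) = 1 / 2 := by
        rw [Real.rpow_neg (by norm_num), ← Real.sqrt_eq_rpow, show (4 : ℝ) = 2 ^ 2 by norm_num,
          Real.sqrt_sq (by norm_num)]; norm_num
      rw [← e]
      exact Real.rpow_le_rpow_of_exponent_le (by norm_num) (by linarith)
    have hpt : ∀ p ∈ Psplit.filter (fun p => ¬ 4 * p ^ 2 ≤ D),
        (p : ℝ) ^ (-s.re) ≤ δ₂ * (charDivisorSum χ p * (Real.sqrt p)⁻¹) := by
      intro p hp
      rw [Finset.mem_filter, not_le] at hp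
      have hpp : p.Prime := hPsplit_prime p hp.1
      have hp1 : (1 : ℝ) ≤ p := by exact_mod_cast hpp.one_lt.le
      have hp0 : (0 : ℝ) < p := by linarith
      have hg : charDivisorSum χ p = 2 := by
        rw [charDivisorSum_prime χ hq hpp, (Finset.mem_filter.mp hp.1).2]; norm_num
      have e1 : (p : ℝ) ^ (-s.re) ≤ (p : ℝ) ^ (-(1 / 2) : ℝ) * (p : ℝ) ^ (-ℓ) := by
        rw [← Real.rpow_add hp0]
        exact Real.rpow_le_rpow_of_exponent_le hp1 (by linarith)
      have hD4p : (D : ℝ) / 4 ≤ (p : ℝ) ^ 2 := by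
        have : (D : ℝ) < 4 * (p : ℝ) ^ 2 := by exact_mod_cast hp.2
        linarith
      have e2 : (p : ℝ) ^ (-ℓ) ≤ 2 * δ₂ := by
        have h1 : ((p : ℝ) ^ 2) ^ (-ℓ / 2) ≤ ((D : ℝ) / 4) ^ (-ℓ / 2) :=
          Real.rpow_le_rpow_of_nonpos hD4pos hD4p (by linarith)
        have h2 : ((p : ℝ) ^ 2) ^ (-ℓ / 2) = (p : ℝ) ^ (-ℓ) := by
          rw [show ((p : ℝ) ^ 2) = (p : ℝ) ^ (2 : ℝ) by norm_cast, ← Real.rpow_mul hp0.le]; ring_nf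
        have h3 : ((D : ℝ) / 4) ^ (-ℓ / 2) ≤ 2 * δ₂ := by
          rw [Real.div_rpow hD0.le (by norm_num)]
          calc (D : ℝ) ^ (-ℓ / 2) / (4 : ℝ) ^ (-ℓ / 2) ≤ (D : ℝ) ^ (-ℓ / 2) / (1 / 2) :=
                div_le_div_of_nonneg_left hδ₂0.le (by norm_num) h4half
            _ = 2 * δ₂ := by rw [hδ₂]; ring
        rw [← h2]; exact h1.trans h3
      calc (p : ℝ) ^ (-s.re) ≤ (p : ℝ) ^ (-(1 / 2) : ℝ) * (p : ℝ) ^ (-ℓ) := e1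
        _ ≤ (p : ℝ) ^ (-(1 / 2) : ℝ) * (2 * δ₂) :=
            mul_le_mul_of_nonneg_left e2 (Real.rpow_nonneg hp0.le _)
        _ = δ₂ * (charDivisorSum χ p * (Real.sqrt p)⁻¹) := by
            rw [hg, Real.rpow_neg hp0.le, ← Real.sqrt_eq_rpow]; ring
    have hsub : Psplit.filter (fun p => ¬ 4 * p ^ 2 ≤ D) ⊆ Finset.Icc 1 D := by
      intro p hp
      rw [Finset.mem_filter] at hp
      have h' := Nat.mem_primesBelow.mp (Finset.mem_filter.mp hp.1).1
      rw [Finset.mem_Icc]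
      exact ⟨h'.2.one_lt.le, by omega⟩
    have hsD : 0 < Real.sqrt D := Real.sqrt_pos.2 hD0
    have hbig : ∑ n ∈ Finset.Icc 1 D, charDivisorSum χ n * (Real.sqrt n)⁻¹ ≤ 25 * X ^ 2 := by
      have h1 := sum_charDivisorSum_div_sqrt_le (K := K) h2 hKD hprim hquad hodd (by omega : 1 ≤ D)
      rw [mul_div_assoc, div_self hsD.ne', mul_one, ← hX] at h1
      have : h * X ≤ X * X := mul_le_mul_of_nonneg_right hhX hX0.le
      have hXX : X ≤ X * X := le_mul_of_one_le_right hX0.le hX1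
      linarith
    calc ∑ p ∈ Psplit.filter (fun p => ¬ 4 * p ^ 2 ≤ D), (p : ℝ) ^ (-s.re)
        ≤ ∑ p ∈ Psplit.filter (fun p => ¬ 4 * p ^ 2 ≤ D),
            δ₂ * (charDivisorSum χ p * (Real.sqrt p)⁻¹) := Finset.sum_le_sum hpt
      _ = δ₂ * ∑ p ∈ Psplit.filter (fun p => ¬ 4 * p ^ 2 ≤ D),
            charDivisorSum χ p * (Real.sqrt p)⁻¹ := by rw [Finset.mul_sum]
      _ ≤ δ₂ * ∑ n ∈ Finset.Icc 1 D, charDivisorSum χ n * (Real.sqrt n)⁻¹ := by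
          refine mul_le_mul_of_nonneg_left
            (Finset.sum_le_sum_of_subset_of_nonneg hsub fun n _ _ => ?_) hδ₂0.le
          exact mul_nonneg (charDivisorSum_nonneg χ hq n) (inv_nonneg.mpr (Real.sqrt_nonneg _))
      _ ≤ δ₂ * (25 * X ^ 2) := mul_le_mul_of_nonneg_left hbig hδ₂0.le
      _ = 25 * X ^ 2 * δ₂ := by ring
  have hS₁le : S₁ ≤ X * δ₁ + 25 * X ^ 2 * δ₂ := by rw [hS₁split]; exact add_le_add hSa hSb
  have hS₁0 : 0 ≤ S₁ := Finset.sum_nonneg fun p _ => Real.rpow_nonneg (Nat.cast_nonneg p) _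
  -- the sizes `X δ₁ ≤ E₀/192`, `X² δ₂ ≤ E₀/4812` (thresholds (2), (3)), so `8 S₁ ≤ ½`
  have hYμ2 : 1 ≤ Yμ * Yμ := one_le_mul_of_one_le_of_one_le hYμ1 hYμ1
  have hδ₁small : X * δ₁ ≤ E₀ / 192 := by
    have : X * δ₁ ≤ X ^ 4 * (Yμ * Yμ) * δ₁ := by
      refine mul_le_mul_of_nonneg_right ?_ hδ₁0.le
      calc X = X ^ 1 := (pow_one X).symm
        _ ≤ X ^ 4 := pow_le_pow_right₀ hX1 (by norm_num)
        _ = X ^ 4 * 1 := (mul_one _).symm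
        _ ≤ X ^ 4 * (Yμ * Yμ) := mul_le_mul_of_nonneg_left hYμ2 (by positivity)
    linarith
  have hδ₂small : X ^ 2 * δ₂ ≤ E₀ / 4812 := by
    have : X ^ 2 * δ₂ ≤ X ^ 5 * (Yμ * Yμ) * δ₂ := by
      refine mul_le_mul_of_nonneg_right ?_ hδ₂0.le
      calc X ^ 2 ≤ X ^ 5 := pow_le_pow_right₀ hX1 (by norm_num)
        _ = X ^ 5 * 1 := (mul_one _).symm
        _ ≤ X ^ 5 * (Yμ * Yμ) := mul_le_mul_of_nonneg_left hYμ2 (by positivity)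
    linarith
  have hS₁small : 8 * S₁ ≤ 1 / 2 := by linarith
  have hW16 : Wsum - 1 ≤ 16 * S₁ := by
    have := exp_sub_one_le_two_mul (by positivity : 0 ≤ 8 * S₁) hS₁small
    linarith
  /- (8) the middle error `‖T − V P‖ ≤ 2X((3/2)Yμ · 16 S₁ + Yμ δ₂)` -/
  have he56 : (2 : ℝ) ^ ω * ((1 + 1 / (2 * s.re - 1)) * (Wsum - 1) +
      2 * (D : ℝ) ^ (1 / 2 - s.re) / (2 * s.re - 1)) ≤
      2 * X * (3 / 2 * Yμ * (16 * S₁) + Yμ * δ₂) := by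
    have hB0 : (0 : ℝ) ≤ 1 + 1 / (2 * s.re - 1) :=
      add_nonneg zero_le_one (one_div_nonneg.mpr (by linarith))
    have hin : (1 + 1 / (2 * s.re - 1)) * (Wsum - 1) + 2 * (D : ℝ) ^ (1 / 2 - s.re) / (2 * s.re - 1)
        ≤ 3 / 2 * Yμ * (16 * S₁) + Yμ * δ₂ := by
      refine add_le_add ?_ htN
      calc (1 + 1 / (2 * s.re - 1)) * (Wsum - 1) ≤ (1 + 1 / (2 * s.re - 1)) * (16 * S₁) :=
            mul_le_mul_of_nonneg_left hW16 hB0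
        _ ≤ 3 / 2 * Yμ * (16 * S₁) := mul_le_mul_of_nonneg_right hB (by positivity)
    have hrhs0 : 0 ≤ 3 / 2 * Yμ * (16 * S₁) + Yμ * δ₂ := by positivity
    calc _ ≤ (2 : ℝ) ^ ω * (3 / 2 * Yμ * (16 * S₁) + Yμ * δ₂) :=
          mul_le_mul_of_nonneg_left hin (by positivity)
      _ ≤ (2 * h) * (3 / 2 * Yμ * (16 * S₁) + Yμ * δ₂) := mul_le_mul_of_nonneg_right hA hrhs0
      _ ≤ (2 * X) * (3 / 2 * Yμ * (16 * S₁) + Yμ * δ₂) :=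
          mul_le_mul_of_nonneg_right (by linarith) hrhs0
  -- `2 X² Yμ (δ₂ + middle) ≤ E₀`
  have hYμYμ : Yμ ≤ Yμ * Yμ := le_mul_of_one_le_right hYμ0.le hYμ1
  have m1 : X ^ 2 * Yμ * δ₂ ≤ X ^ 5 * (Yμ * Yμ) * δ₂ := by
    refine mul_le_mul_of_nonneg_right ?_ hδ₂0.le
    exact mul_le_mul (pow_le_pow_right₀ hX1 (by norm_num)) hYμYμ hYμ0.le (by positivity)
  have m2 : X ^ 3 * (Yμ * Yμ) * S₁ ≤
      X ^ 4 * (Yμ * Yμ) * δ₁ + 25 * (X ^ 5 * (Yμ * Yμ) * δ₂) := by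
    have := mul_le_mul_of_nonneg_left hS₁le (by positivity : 0 ≤ X ^ 3 * (Yμ * Yμ))
    have e : X ^ 3 * (Yμ * Yμ) * (X * δ₁ + 25 * X ^ 2 * δ₂) =
        X ^ 4 * (Yμ * Yμ) * δ₁ + 25 * (X ^ 5 * (Yμ * Yμ) * δ₂) := by ring
    linarith
  have m3 : X ^ 3 * (Yμ * Yμ) * δ₂ ≤ X ^ 5 * (Yμ * Yμ) * δ₂ :=
    mul_le_mul_of_nonneg_right (mul_le_mul_of_nonneg_right
      (pow_le_pow_right₀ hX1 (by norm_num)) (by positivity)) hδ₂0.le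
  have hii0 : 2 * X ^ 2 * Yμ * (δ₂ + 2 * X * (3 / 2 * Yμ * (16 * S₁) + Yμ * δ₂)) ≤ E₀ := by
    have e : 2 * X ^ 2 * Yμ * (δ₂ + 2 * X * (3 / 2 * Yμ * (16 * S₁) + Yμ * δ₂)) =
        2 * (X ^ 2 * Yμ * δ₂) + 96 * (X ^ 3 * (Yμ * Yμ) * S₁) +
          4 * (X ^ 3 * (Yμ * Yμ) * δ₂) := by ring
    rw [e]; linarith
  /- (9) lower bounds `‖ζ(2s)‖ ≥ ℓ`, `‖P‖ ≥ 4^{−ω} ≥ 1/(4X²)`, and the conclusion -/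
  have hζ2 : ℓ ≤ ‖riemannZeta (2 * s)‖ := by
    have := norm_zeta_two_mul_ge' hσ hσ1; linarith
  have hPlow : ((1 / 4 : ℝ)) ^ ω ≤ ‖P‖ := norm_prod_one_add_ge hσ0
  have hPlow' : 1 / (4 * X ^ 2) ≤ ((1 / 4 : ℝ)) ^ ω := by
    have h4ω : ((1 / 4 : ℝ)) ^ ω = 1 / ((2 : ℝ) ^ ω) ^ 2 := by
      rw [one_div_pow, show (4 : ℝ) = 2 ^ 2 by norm_num, ← pow_mul, pow_mul']
    rw [h4ω]
    refine one_div_le_one_div_of_le (by positivity) ?_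
    have hA2X : (2 : ℝ) ^ ω ≤ 2 * X := hA.trans (by linarith)
    have hA0 : 0 ≤ (2 : ℝ) ^ ω := by positivity
    calc ((2 : ℝ) ^ ω) ^ 2 ≤ (2 * X) ^ 2 := pow_le_pow_left₀ hA0 hA2X 2
      _ = 4 * X ^ 2 := by ring
  have hP0 : 0 < ‖P‖ := lt_of_lt_of_le (by positivity) hPlow
  have hζ20 : 0 < ‖riemannZeta (2 * s)‖ := lt_of_lt_of_le hℓ0 hζ2
  set E : ℂ := riemannZeta s * χ.LFunction s - riemannZeta (2 * s) * P with hEdef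
  have hEle : ‖E‖ ≤ δ₂ + (2 : ℝ) ^ ω * ((1 + 1 / (2 * s.re - 1)) * (Wsum - 1) +
      2 * (D : ℝ) ^ (1 / 2 - s.re) / (2 * s.re - 1)) +
      (R : ℝ) ^ (1 - 2 * s.re) / (2 * s.re - 1) * ‖P‖ := by
    have hsplit : E = -(T - riemannZeta s * χ.LFunction s) + (T - V * P) +
        (V - riemannZeta (2 * s)) * P := by rw [hEdef]; ring
    rw [hsplit]
    refine (norm_add_le _ _).trans (add_le_add ((norm_add_le _ _).trans (add_le_add ?_ hTV)) ?_)
    · rw [norm_neg]; exact hT2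
    · rw [norm_mul]; exact mul_le_mul_of_nonneg_right hV (norm_nonneg _)
  have hmain : ‖E‖ ≤ 4 * E₀ * (‖riemannZeta (2 * s)‖ * ‖P‖) := by
    -- (i) the `R`-tail, relative to `P` exactly
    have hi : (R : ℝ) ^ (1 - 2 * s.re) / (2 * s.re - 1) * ‖P‖ ≤
        2 * E₀ * (‖riemannZeta (2 * s)‖ * ‖P‖) := by
      calc (R : ℝ) ^ (1 - 2 * s.re) / (2 * s.re - 1) * ‖P‖ ≤ (2 * ℓ * E₀) * ‖P‖ :=
            mul_le_mul_of_nonneg_right htailR (norm_nonneg _)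
        _ = 2 * E₀ * (ℓ * ‖P‖) := by ring
        _ ≤ 2 * E₀ * (‖riemannZeta (2 * s)‖ * ‖P‖) :=
            mul_le_mul_of_nonneg_left (mul_le_mul_of_nonneg_right hζ2 (norm_nonneg _))
              (by positivity)
    -- (ii) the two absolute errors against `ℓ · 4^{−ω} ≥ ℓ/(4X²)`
    have hii1 : δ₂ + (2 : ℝ) ^ ω * ((1 + 1 / (2 * s.re - 1)) * (Wsum - 1) +
        2 * (D : ℝ) ^ (1 / 2 - s.re) / (2 * s.re - 1)) ≤ E₀ / (2 * X ^ 2 * Yμ) := by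
      rw [le_div_iff₀ (by positivity)]
      have := mul_le_mul_of_nonneg_left (add_le_add_left he56 δ₂)
        (by positivity : (0 : ℝ) ≤ 2 * X ^ 2 * Yμ)
      linarith
    have hii2 : E₀ / (2 * X ^ 2 * Yμ) = 2 * E₀ * (ℓ * (1 / (4 * X ^ 2))) := by
      rw [hℓeq]; field_simp; ring
    have hii : δ₂ + (2 : ℝ) ^ ω * ((1 + 1 / (2 * s.re - 1)) * (Wsum - 1) +
        2 * (D : ℝ) ^ (1 / 2 - s.re) / (2 * s.re - 1)) ≤
        2 * E₀ * (‖riemannZeta (2 * s)‖ * ‖P‖) := by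
      refine (hii1.trans_eq hii2).trans (mul_le_mul_of_nonneg_left ?_ (by positivity))
      exact mul_le_mul hζ2 (hPlow'.trans hPlow) (by positivity) (norm_nonneg _)
    calc ‖E‖ ≤ _ := hEle
      _ ≤ 2 * E₀ * (‖riemannZeta (2 * s)‖ * ‖P‖) + 2 * E₀ * (‖riemannZeta (2 * s)‖ * ‖P‖) :=
          add_le_add hii hi
      _ = 4 * E₀ * (‖riemannZeta (2 * s)‖ * ‖P‖) := by ring
  -- `‖E‖ < ‖ζ(2s) P‖` (as `4E₀ ≤ ½`), hence `ζ(s) ≠ 0`, `L(s, χ) ≠ 0`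
  have hnormZP : ‖riemannZeta (2 * s) * P‖ = ‖riemannZeta (2 * s)‖ * ‖P‖ := norm_mul _ _
  have hZP0 : 0 < ‖riemannZeta (2 * s)‖ * ‖P‖ := mul_pos hζ20 hP0
  have hEsmall : ‖E‖ < ‖riemannZeta (2 * s) * P‖ := by
    rw [hnormZP]
    have : 4 * E₀ * (‖riemannZeta (2 * s)‖ * ‖P‖) ≤ 1 / 2 * (‖riemannZeta (2 * s)‖ * ‖P‖) :=
      mul_le_mul_of_nonneg_right (by linarith) hZP0.le
    linarith
  have hζne : riemannZeta s ≠ 0 := by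
    intro h0
    have : E = -(riemannZeta (2 * s) * P) := by rw [hEdef, h0, zero_mul, zero_sub]
    rw [this, norm_neg] at hEsmall
    exact lt_irrefl _ hEsmall
  have hLne : χ.LFunction s ≠ 0 := by
    intro h0
    have : E = -(riemannZeta (2 * s) * P) := by rw [hEdef, h0, mul_zero, zero_sub]
    rw [this, norm_neg] at hEsmall
    exact lt_irrefl _ hEsmall
  refine ⟨hLne, hζne, ?_⟩
  -- `L(s) − M(s) = E/ζ(s)` and `‖M(s)‖ = ‖ζ(2s)P‖/‖ζ(s)‖`
  have hζpos : 0 < ‖riemannZeta s‖ := norm_pos_iff.mpr hζne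
  have hM : mainTerm D s = riemannZeta (2 * s) * P / riemannZeta s := by
    rw [mainTerm, hPdef]; ring
  have hdiff : χ.LFunction s - mainTerm D s = E / riemannZeta s := by
    rw [hM, hEdef]; field_simp
  have hnormM : ‖mainTerm D s‖ = ‖riemannZeta (2 * s)‖ * ‖P‖ / ‖riemannZeta s‖ := by
    rw [hM, norm_div, hnormZP]
  rw [hdiff, norm_div, hnormM]
  calc ‖E‖ / ‖riemannZeta s‖ ≤ 4 * E₀ * (‖riemannZeta (2 * s)‖ * ‖P‖) / ‖riemannZeta s‖ :=
        div_le_div_of_nonneg_right hmain hζpos.le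
    _ = ‖riemannZeta (2 * s)‖ * ‖P‖ / ‖riemannZeta s‖ * 4 * E₀ := by ring

end Core

/-! ### The named facts, discharged -/

section Discharge

/-- **Bellotti–Puglisi 2023, Theorem 1 — the named fact `bellottiPuglisi2023_theorem1`, DISCHARGED**
(with `C = 4` and an effective `q₀(η, μ)`): for `0 < μ`, `max(μ, 1) < η`, every imaginary quadratic
field `K` with `q = |d_K| ≥ q₀` and `h(−q) ≤ log q/(log log q)^η`, the odd real primitive character
`χ` mod `q` and every `s ∈ H(ℓ, q)`:
`‖L(s, χ) − M(s)‖ ≤ ‖M(s)‖ · C · exp(−⅓(log log q)^{η−μ})`, `M(s) = ζ(2s)ζ(s)⁻¹∏_{p∣q}(1 + p^{−s})`.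
[cite: BellottiPuglisi2023, Theorem 1 p. 3; proof §2 pp. 5–10] -/
theorem _root_.Literature.NumberTheory.LFunctions.bellottiPuglisi2023_theorem1_holds :
    bellottiPuglisi2023_theorem1 := by
  intro η μ hμ hη
  obtain ⟨D₀, hD₀⟩ := theorem1_core hμ hη
  exact ⟨4, D₀, fun K _ _ _ h2 hd hD hh χ hquad hprim hodd s hs =>
    (hD₀ _ K h2 hd rfl hD hh χ hquad hprim hodd s hs).2.2⟩

/-- **Bellotti–Puglisi 2023, Corollary 1 — the named fact `bellottiPuglisi2023_corollary1`,
DISCHARGED:** if `ζ(β + iγ) = 0` with `β > ½`, then for every `η > 1` there is `q₀ = q₀(β, γ, η)`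
such that every imaginary quadratic field with `q = |d_K| > q₀` has `h(−q) > log q/(log log q)^η`.
(From Theorem 1 with `μ = min(1, η−1)/2`: for `q` large the zero lies in `H(ℓ, q)`, where `ζ ≠ 0`
as soon as `h(−q) ≤ log q/(log log q)^η`.) [cite: BellottiPuglisi2023, Corollary 1 p. 4] -/
theorem _root_.Literature.NumberTheory.LFunctions.bellottiPuglisi2023_corollary1_holds :
    bellottiPuglisi2023_corollary1 := by
  intro β γ hβ hz η hη
  set s : ℂ := β + γ * Complex.I with hsdef
  have hsre : s.re = β := by simp [hsdef]
  -- `β < 1` (no zeros on `Re s ≥ 1`)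
  have hβ1 : β < 1 := by
    by_contra hle
    push Not at hle
    exact riemannZeta_ne_zero_of_one_le_re (s := s) (by rw [hsre]; exact hle) hz
  -- `μ = min(1, η − 1)/2`
  set μ : ℝ := min 1 (η - 1) / 2 with hμdef
  have hmin1 := min_le_left (1 : ℝ) (η - 1)
  have hmin2 := min_le_right (1 : ℝ) (η - 1)
  have hμ0 : 0 < μ := by rw [hμdef]; exact div_pos (lt_min one_pos (by linarith)) two_pos
  have hμη : max μ 1 < η := by
    rw [max_lt_iff]; refine ⟨?_, hη⟩; rw [hμdef]; linarith
  obtain ⟨D₁, hD₁⟩ := theorem1_core hμ0 hμη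
  -- thresholds in `Y = log log D`
  set τ : ℝ := 1 - β with hτdef
  have hτ0 : 0 < τ := by rw [hτdef]; linarith
  have hn0 : 0 < ‖s‖ := by
    have h1 := Complex.abs_re_le_norm s
    rw [hsre, abs_of_pos (by linarith : 0 < β)] at h1
    linarith
  have e0 : ∀ᶠ Y : ℝ in atTop, 1 ≤ Y := Filter.eventually_ge_atTop 1
  have e1 : ∀ᶠ Y : ℝ in atTop, 1 / τ ≤ Y := Filter.eventually_ge_atTop _
  have e2 : ∀ᶠ Y : ℝ in atTop, Y ^ (-μ) ≤ β - 1 / 2 := by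
    have ht := tendsto_rpow_neg_atTop hμ0
    exact (ht.eventually (Iic_mem_nhds (by linarith : (0 : ℝ) < β - 1 / 2))).mono fun Y hY => hY
  have e3 : ∀ᶠ Y : ℝ in atTop,
      Y ^ μ * Real.exp (-(1 : ℝ) * Y) ≤ 1 / (10 * |Real.log ‖s‖| + 1) := by
    have ht := tendsto_rpow_mul_exp_neg_mul_atTop_nhds_zero μ 1 one_pos
    exact (ht.eventually (Iic_mem_nhds (by positivity))).mono fun Y hY => hY
  obtain ⟨Y₁, hY₁⟩ := Filter.eventually_atTop.mp (e0.and (e1.and (e2.and e3)))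
  refine ⟨max D₁ ⌈Real.exp (Real.exp Y₁)⌉₊, fun K _ _ h2 hneg hD => ?_⟩
  haveI := Literature.NumberTheory.QuadraticFields.Quadratic.neZero_natAbs_discr (K := K)
  set D : ℕ := (NumberField.discr K).natAbs with hDdef
  have hD₁D : D₁ ≤ D := (lt_of_le_of_lt (le_max_left _ _) hD).le
  have hDexp : ⌈Real.exp (Real.exp Y₁)⌉₊ < D := lt_of_le_of_lt (le_max_right _ _) hD
  by_contra hle
  push Not at hle
  obtain ⟨κ, hquad, hprim, hodd⟩ := exists_odd_quadratic_primitive_char h2 hneg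
  have hD0 : (0 : ℝ) < D := by
    have h1 : Real.exp (Real.exp Y₁) ≤ ⌈Real.exp (Real.exp Y₁)⌉₊ := Nat.le_ceil _
    have h2 : (⌈Real.exp (Real.exp Y₁)⌉₊ : ℝ) < D := by exact_mod_cast hDexp
    linarith [Real.exp_pos (Real.exp Y₁)]
  set X : ℝ := Real.log D with hX
  have hXexp : Real.exp Y₁ ≤ X := by
    rw [hX, Real.le_log_iff_exp_le hD0]
    exact le_trans (Nat.le_ceil _) (by exact_mod_cast hDexp.le)
  have hX0 : 0 < X := lt_of_lt_of_le (Real.exp_pos _) hXexp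
  set Y : ℝ := Real.log X with hY
  have hYY₁ : Y₁ ≤ Y := by rw [hY, Real.le_log_iff_exp_le hX0]; exact hXexp
  obtain ⟨hY1, hτY, hβY, hexpY'⟩ := hY₁ Y hYY₁
  have hY0 : 0 < Y := by linarith
  have hexpY : Real.exp Y = X := by rw [hY, Real.exp_log hX0]
  have hXY : Y + 1 ≤ X := by rw [← hexpY]; exact Real.add_one_le_exp Y
  have hX1 : 1 < X := by linarith
  -- `s ∈ H(ℓ, D)`
  have hmem : s ∈ region μ D := by
    refine ⟨?_, ?_, ?_, ?_⟩
    · -- `(log D)^{−4} ≤ ‖1 − s‖`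
      rw [← hX]
      have h1 : τ ≤ ‖1 - s‖ := by
        have := Complex.abs_re_le_norm (1 - s)
        rw [sub_re, one_re, hsre] at this
        have hτ' : |1 - β| = τ := abs_of_pos hτ0
        linarith [hτ'.symm.le, this]
      refine le_trans ?_ h1
      calc X ^ (-(4 : ℝ)) ≤ X ^ (-(1 : ℝ)) := Real.rpow_le_rpow_of_exponent_le hX1.le (by norm_num)
        _ = 1 / X := by rw [Real.rpow_neg_one, one_div]
        _ ≤ 1 / Y := one_div_le_one_div_of_le hY0 (by linarith)
        _ ≤ τ := by
            rw [div_le_iff₀ hY0]; rw [div_le_iff₀ hτ0] at hτY; linarith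
    · rw [← hX, ← hY, hsre]; linarith
    · rw [hsre]; exact hβ1.le
    · -- `‖s‖ ≤ D^{ℓ/10}` iff `log ‖s‖ ≤ (ℓ/10) log D`
      rw [← hX, ← hY, Real.le_rpow_iff_log_le hn0 hD0, ← hX]
      have hYμ0 : 0 < Y ^ μ := Real.rpow_pos_of_pos hY0 _
      have hkey : (10 * |Real.log ‖s‖| + 1) * Y ^ μ ≤ X := by
        rw [show -(1 : ℝ) * Y = -Y by ring, Real.exp_neg, mul_inv_le_iff₀ (Real.exp_pos Y),
          hexpY] at hexpY'
        calc (10 * |Real.log ‖s‖| + 1) * Y ^ μ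
            ≤ (10 * |Real.log ‖s‖| + 1) * (1 / (10 * |Real.log ‖s‖| + 1) * X) :=
              mul_le_mul_of_nonneg_left hexpY' (by positivity)
          _ = X := by field_simp
      have habs : Real.log ‖s‖ ≤ |Real.log ‖s‖| := le_abs_self _
      rw [Real.rpow_neg hY0.le, show (Y ^ μ)⁻¹ / 10 * X = X / (10 * Y ^ μ) by field_simp,
        le_div_iff₀ (by positivity)]
      linarith [mul_nonneg (sub_nonneg.mpr habs) hYμ0.le]
  exact (hD₁ D K h2 hneg rfl hD₁D hle κ hquad hprim hodd s hmem).2.1 hz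

/-- **Corollary 1 contraposed, unconditional (PROVED):** if for some `η > 1` there are imaginary
quadratic fields `K` of arbitrarily large `q = |d_K|` with `h_K ≤ log q/(log log q)^η`, then
`ζ(s) ≠ 0` for `Re s > ½` — the statement file's `riemannZeta_ne_zero_of_frequently_small_classNumber`
fed with `bellottiPuglisi2023_corollary1_holds`. [cite: BellottiPuglisi2023, Corollary 1 p. 4] -/
theorem riemannZeta_ne_zero_of_frequently_small_classNumber' {η : ℝ} (hη : 1 < η)
    (hsmall : ∀ q₀ : ℕ, ∃ (K : Type) (_ : Field K) (_ : NumberField K),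
      Module.finrank ℚ K = 2 ∧ NumberField.discr K < 0 ∧ q₀ < (NumberField.discr K).natAbs ∧
        (NumberField.classNumber K : ℝ) ≤
          Real.log (NumberField.discr K).natAbs /
            Real.log (Real.log (NumberField.discr K).natAbs) ^ η)
    {s : ℂ} (hs : 1 / 2 < s.re) : riemannZeta s ≠ 0 :=
  riemannZeta_ne_zero_of_frequently_small_classNumber bellottiPuglisi2023_corollary1_holds hη hsmall hs

end Discharge

end BellottiPuglisi2023

end Literature.NumberTheory.LFunctions

end
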